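/-
Copyright (c) 2026 the pub-hodgecm-mathlib formalisation cell (harness21).  Prover seat hodgecm-mathlib-K2E1-p14 (g2) (DRAFT for the definition seat K2-defs1; R90-TF S8
«E-S8-def» D-S8-2, R90-CS-plan 15:54:57Z), Track B «K2-LIT» ENGINE E1, h413 = `stmt-HodgeConjecture-24833`, route `HCCMUnconditional`: the CONTINUOUS-SPECTRUM TRACE NUMBERS
`Tr I_{H,χ}(f)`, `Tr(M_H(χ) I_{H,χ}(f))` of §13.6 (13.6.1) on the `U(Φ₂)` factor AT THE MAXIMAL LEVEL, as numbers pinned to THE scattering package of the E1 estate.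
-/
import Summits.HodgeConjecture.HodgeConjecture.Theorems.K2E1ChiScatteringRealPolesM1CMTwoComplete     -- ★ p860788 (K2E1-p13): THE package `chi_scattering_real_poles_m1_complete_cm_two`
import HarnessLib

/-!
# D-S8-2 — `K2E1ContSpecTraceNumbersU2Defs`: THE CONTINUOUS-SPECTRUM TRACE NUMBERS `Tr I_{H,χ}(f)` AND `Tr(M_H(χ) I_{H,χ}(f))` OF (13.6.1) ON `U(Φ₂) = U(1,1)_{L∕L⁺}` AT THE
# MAXIMAL LEVEL, PINNED TO THE ★ SCATTERING PACKAGE (R90-TF S8 «E-S8-def», tokens `trIH`, `trMIH` of `Rogawski1990.Ch13Sec5Defs` :163–:165)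

Track B ∕ K2-LIT, crux h413 = `stmt-HodgeConjecture-24833`, route of record `HCCMUnconditional`; cell `hodgecm-mathlib`, R90-TF slab S8 (ContSpec-n½).  DEFINITIONS FILE
(`--kind definition`, review-queued; proposed by the definition seat K2-defs1; drafted by K2E1-p14 (g2), census `K2/K2E1-p14/g2/CENSUS-S8-contU2.md` 52c5c0ffcf668495): FOUR
`def`s + their read-back theorems; no `instance`, no `notation`, no named-fact hypothesis, no `sorry`; default heartbeats.

THE MATHEMATICS ([Rogawski1990, §13.6 (13.6.1) p. 208; Prop. 13.6.1 (3′) p. 209]; [MoeglinWaldspurger1995, II.1.7, IV.1.10]; [Arthur1982EisensteinII, Thm. 8.2]).  On `H`'s factor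
`U(Φ₂)`, for a self-dual (`χ = wχ`) unitary Hecke character `χ` of `L` and a test function `f` that is bi-`K_max`-invariant, the induced representation `I_{H,χ}` at the centre `z = ½` has its
`K_max`-fixed vectors of dimension ≤ 1 (★ `finrank_chiSectionSpace_maximalLevel_le_one_cm`), spanned by the normalised section `φ ∈ V(χ, K_max, 1)`; `I_χ(f)` maps into that line and
acts on it by the `χ`-SPHERICAL SYMBOL `ŝ_f(χ, z) = φ(1)⁻¹ · ∫_{G(𝔸)} f(y) f_z^φ(y) dν_G(y)` (the `hact` currency of ★ `K2E1SelfDualModelHeckeIntertwining`: `∫ f(y) f_z^φ(xy) dy = ŝ_f(z) f_z^φ(x)`), so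
**`Tr I_{H,χ}(f) = ŝ_f(χ, ½)`** (§1 `trIH_m1`); the intertwining operator `M_H(χ)(z)` acts on the line by THE scattering scalar `s = qc default` of the ONE pinned package (★
`chi_scattering_real_poles_m1_complete_cm_two`: tube formula `s(z) = (ν𝓕)⁻¹ φ(1)⁻¹ ∫_N f_z^φ(w₀ n) dn`, meromorphic in normal form, analytic off a closed co-discrete `P ⊆ {Re ≤ 1}`, analytic at
`½` ★ p860080), so **`Tr(M_H(χ) I_{H,χ}(f)) = s(½) · ŝ_f(χ, ½)`** (§3 `trMIH_m1`) with **`s(½) = ±1`** (★ p861469; the SIGN is external content, [KeysShahidi1988] Thm. 5.1 — S8's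
`sock_S8_ext_kysCentreU2`).  §2 pins `s` and `P` as DEFINITIONS (`scatteringScalarM1`, `scatteringPolesM1` — `Classical.choose` on the ★ package, so every consumer reads THE SAME scalar: the
one-source rule by construction) with read-backs: the tube formula, normal form, the pole set's properties, analyticity off it.
The centre value `s(½) = ±1` is ★ `K2E1ChiScatteringCentreValueSignM1CMTwo.chi_scattering_centre_value_sq_m1_cm_two` on the package clauses (a def-spelled read-back is deferred:
rewriting the `Classical.choose`-spelled clauses exceeds the default elaboration budget).
* §1 `chiSphericalSymbol`, `trIH_m1` (+ `rfl` read-backs).  * §2 `scatteringScalarM1`, `scatteringPolesM1` (+ read-backs).  * §3 `trMIH_m1` (+ `rfl` read-back; `trMIH = ±trIH` via ★ p861469).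
ONE SOURCE IS PER BINDER TUPLE (R90-CS-audit1 (n1)): the value of `scatteringScalarM1` is `Classical.choose` of a proof whose PROPOSITION mentions the data binders
`(μ, νG, μK, νI, 𝓕I, ν, 𝓕, β, μZ, χ, φ)`; the Prop binders are irrelevant (proof irrelevance, `rfl`), but across two DIFFERENT data tuples equality of the scalars is a THEOREM (tube formula +
identity principle, cf. ★ `K2E1ChiScatteringPackageUniqueU2`), not `rfl` — every S8 consumer (A ED.2's `ov_cm`, `spectralTermsU3_cm`) must thread the kit-of-record's ONE tuple.
SCOPE (honest): M1 only (`K′ = K_max`, `ω = 1`, bi-`K_max`-invariant `f`): at a general `K`-type the continuation of `M_H(χ)` is ★ only hypothesis-first (level packages, letters `hdec`-level ∕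
gauge symbols), so the general blockwise `Σ_{blocks} tr(I_χ(f)|_V ∘ M(½)|_V)` is NOT defined here (census §1 last row, §3).
HONEST LABEL: HC_CM is proved only modulo the 7 printed citations (2 remaining named inputs: hLiu418 = `stmt-HodgeConjecture-24832`, h413 = `stmt-HodgeConjecture-24833`) until rung 0
closes; definitions + read-backs only, closes no socket; count-neutral.

## References
* [Rogawski1990] J. Rogawski, *Automorphic Representations of Unitary Groups in Three Variables*, Ann. of Math. Stud. 123 (1990), §13.6 (13.6.1) p. 208, Prop. 13.6.1 p. 209.
* [MoeglinWaldspurger1995] C. Mœglin, J.-L. Waldspurger, *Spectral decomposition and Eisenstein series* (1995), II.1.7, IV.1.10.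
* [Arthur1982EisensteinII] J. Arthur, *On a family of distributions obtained from Eisenstein series II*, Amer. J. Math. 104 (1982), Thm. 8.2.
* [KeysShahidi1988] D. Keys, F. Shahidi, *Artin L-functions and normalization of intertwining operators*, Ann. Sci. ÉNS 21 (1988), Thm. 5.1.
-/

set_option autoImplicit false
set_option linter.dupNamespace false  -- the mandated namespace repeats the summit's segment (`HodgeConjecture.HodgeConjecture`)

noncomputable section

open MeasureTheory MeasureTheory.Measure Set NumberField IsDedekindDomain Filter Topology
open scoped NNReal ENNReal ComplexConjugate
open Literature.MeasureTheory.Group Literature.NumberTheory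
open Literature.NumberTheory.Automorphic Literature.NumberTheory.Automorphic.UnitaryGroup AdelicGroupData
open Literature.NumberTheory.GaloisRepresentations
open Summit.HodgeConjecture.HodgeConjecture.Cruxes.H413.K2E1BorelEisensteinU
open Summit.HodgeConjecture.HodgeConjecture.Cruxes.H413.K2E1BLBorelSpacesU2Defs
open Summit.HodgeConjecture.HodgeConjecture.Cruxes.H413.K2E1BLBorelOperatorsU2Defs
open Summit.HodgeConjecture.HodgeConjecture.Cruxes.H413.K2E1CharacterEisensteinU2Defs
open Summit.HodgeConjecture.HodgeConjecture.Cruxes.H413.K2E1ChiSectionSpaceU2Defs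
open Summit.HodgeConjecture.HodgeConjecture.Cruxes.H413.K2E1ChiScatteringRealPolesM1CMTwoComplete (chi_scattering_real_poles_m1_complete_cm_two)

namespace Summit.HodgeConjecture.HodgeConjecture.Cruxes.H413.K2E1ContSpecTraceNumbersU2Defs

variable (L : Type) [Field L] [NumberField L] [IsCMField L]
variable [MeasurableSpace (quasiSplit (↥(maximalRealSubfield L)) L (IsCMField.complexConj L) 2).Adelic]

/-! ## §1 The `χ`-spherical symbol and `Tr I_{H,χ}(f)` at the maximal level -/

/-- **THE `χ`-SPHERICAL SYMBOL** `ŝ_f(χ, z) := φ(1)⁻¹ · ∫_{G(𝔸)} f(y) · f_z^φ(y) dν_G(y)` of a test function `f` on `G(𝔸) = U(1,1)(𝔸_{L⁺})` against the flat section of the (normalised) `χ`-section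
`φ ∈ V(χ, K_max, 1)`: for `f` bi-`K_max`-invariant, `I_χ(f)` acts on the `K_max`-fixed line of `I_χ(z)` by this scalar (the `hact` currency `∫ f(y) f_z^φ(xy) dy = ŝ_f(z)·f_z^φ(x)` of ★
`K2E1SelfDualModelHeckeIntertwining`, read at `x = 1` where `f_z^φ(1) = φ(1)`). [cite: Rogawski1990, Prop. 13.6.1 (3′) p. 209] [cite: MoeglinWaldspurger1995, II.1.7] -/
def chiSphericalSymbol (νG : Measure (quasiSplit (↥(maximalRealSubfield L)) L (IsCMField.complexConj L) 2).Adelic)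
    (φ f : (quasiSplit (↥(maximalRealSubfield L)) L (IsCMField.complexConj L) 2).Adelic → ℂ) (z : ℂ) : ℂ :=
  (φ 1)⁻¹ * ∫ y, f y * flatSectionU φ z y ∂νG

/-- Read-back of `chiSphericalSymbol` (definitional). [folklore] -/
theorem chiSphericalSymbol_def (νG : Measure (quasiSplit (↥(maximalRealSubfield L)) L (IsCMField.complexConj L) 2).Adelic)
    (φ f : (quasiSplit (↥(maximalRealSubfield L)) L (IsCMField.complexConj L) 2).Adelic → ℂ) (z : ℂ) :
    chiSphericalSymbol L νG φ f z = (φ 1)⁻¹ * ∫ y, f y * flatSectionU φ z y ∂νG := rfl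

/-- **`Tr I_{H,χ}(f)` AT THE MAXIMAL LEVEL** (token `trIH` of `Ch13Sec5Defs` :163, `U(Φ₂)` factor, bi-`K_max`-invariant `f`): the `χ`-spherical symbol at the centre `z = ½` — `I_χ(f)`
has rank ≤ 1 with image the `K_max`-line, on which it acts by `ŝ_f(χ, ½)`. [cite: Rogawski1990, §13.6 (13.6.1) p. 208] [cite: Rogawski1990, Prop. 13.6.1 (3′) p. 209] -/
def trIH_m1 (νG : Measure (quasiSplit (↥(maximalRealSubfield L)) L (IsCMField.complexConj L) 2).Adelic)
    (φ f : (quasiSplit (↥(maximalRealSubfield L)) L (IsCMField.complexConj L) 2).Adelic → ℂ) : ℂ :=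
  chiSphericalSymbol L νG φ f (1 / 2)

/-- Read-back of `trIH_m1` (definitional). [folklore] -/
theorem trIH_m1_def (νG : Measure (quasiSplit (↥(maximalRealSubfield L)) L (IsCMField.complexConj L) 2).Adelic)
    (φ f : (quasiSplit (↥(maximalRealSubfield L)) L (IsCMField.complexConj L) 2).Adelic → ℂ) :
    trIH_m1 L νG φ f = (φ 1)⁻¹ * ∫ y, f y * flatSectionU φ (1 / 2) y ∂νG := rfl

/-! ## §2 THE scattering scalar and THE pole set of the M1 datum, as definitions (one source by construction) -/

section Package

variable [BorelSpace (quasiSplit (↥(maximalRealSubfield L)) L (IsCMField.complexConj L) 2).Adelic] [MeasurableSpace (AdeleRing (𝓞 L) L)ˣ] [BorelSpace (AdeleRing (𝓞 L) L)ˣ]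
variable (μ : Measure (quasiSplit (↥(maximalRealSubfield L)) L (IsCMField.complexConj L) 2).automorphicQuotient) [(quasiSplit (↥(maximalRealSubfield L)) L (IsCMField.complexConj L) 2).IsAutomorphicMeasure μ]
variable (νG : Measure (quasiSplit (↥(maximalRealSubfield L)) L (IsCMField.complexConj L) 2).Adelic) [νG.IsHaarMeasure] [νG.IsInvInvariant] [SFinite νG]
variable (μK : Measure ↥((standardMaximalCompactGL 2 L).comap (adelicVal (↥(maximalRealSubfield L)) L (IsCMField.complexConj L) 2 ((StdForm.antidiagonal 2).over L)) : Subgroup (quasiSplit (↥(maximalRealSubfield L)) L (IsCMField.complexConj L) 2).Adelic)) [μK.IsHaarMeasure]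
variable (νI : Measure (AdeleRing (𝓞 L) L)ˣ) [νI.IsHaarMeasure]
variable {𝓕I : Set (AdeleRing (𝓞 L) L)ˣ} (h𝓕I : IsIdeleClassDomain L 𝓕I)
variable (ν : Measure ↥(adelicUnipotent (↥(maximalRealSubfield L)) L (IsCMField.complexConj L) 2)) [ν.IsHaarMeasure] [ν.IsMulRightInvariant] [ν.IsInvInvariant]
variable {𝓕 : Set ↥(adelicUnipotent (↥(maximalRealSubfield L)) L (IsCMField.complexConj L) 2)}
variable (h𝓕N : IsFundamentalDomain ↥(rationalUnipotent (↥(maximalRealSubfield L)) L (IsCMField.complexConj L) 2) 𝓕 ν) (h𝓕1 : ν 𝓕 = 1) (h𝓕c : IsCompact (closure 𝓕))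
variable {β : (quasiSplit (↥(maximalRealSubfield L)) L (IsCMField.complexConj L) 2).Adelic → ℝ≥0∞}
variable (hβ : IsCoveringWeight ↥((arithmeticBorel (↥(maximalRealSubfield L)) L (IsCMField.complexConj L) 2).map (quasiSplit (↥(maximalRealSubfield L)) L (IsCMField.complexConj L) 2).arithmeticSubgroup.subtype) β)
variable {μZ : Measure (borelQuotient (↥(maximalRealSubfield L)) L (IsCMField.complexConj L) 2)} [SFinite μZ]
variable (hμZ : ∀ f : borelQuotient (↥(maximalRealSubfield L)) L (IsCMField.complexConj L) 2 → ℝ≥0∞, Measurable f → ∫⁻ z, f z ∂μZ = ∫⁻ g, β g * f (toBorelQuotient (↥(maximalRealSubfield L)) L (IsCMField.complexConj L) 2 g) ∂νG)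
variable {χ : HeckeCharacter L} (hχ : χ.IsUnitary) (hρ : ∀ r : ℝ≥0ˣ, χ (posRealIdele L r) = 1) (hsd : reflectChar (IsCMField.complexConj L) χ = χ)
variable {φ : (quasiSplit (↥(maximalRealSubfield L)) L (IsCMField.complexConj L) 2).Adelic → ℂ}
variable (hφV : φ ∈ chiSectionSpace χ ((standardMaximalCompactGL 2 L).comap (adelicVal (↥(maximalRealSubfield L)) L (IsCMField.complexConj L) 2 ((StdForm.antidiagonal 2).over L)) : Subgroup (quasiSplit (↥(maximalRealSubfield L)) L (IsCMField.complexConj L) 2).Adelic) (fun _ => 1))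
variable (hφc : Continuous φ) {Mφ : ℝ} (hφM : ∀ x, ‖φ x‖ ≤ Mφ)
variable (hφinf : ∀ a : arch (↥(maximalRealSubfield L)) L (IsCMField.complexConj L) 2 ((StdForm.antidiagonal 2).over L), φ (archToAdelic (↥(maximalRealSubfield L)) L (IsCMField.complexConj L) 2 _ a) = φ 1)
variable (hφ1 : φ 1 ≠ 0) (hφ1r : conj (φ 1) = φ 1)

/-- **THE SCATTERING SCALAR `s = M_H(χ)|_{V(χ,K_max,1)}` OF THE M1 DATUM, AS A DEFINITION**: the continued scalar `qc default : ℂ → ℂ` of THE package ★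
`chi_scattering_real_poles_m1_complete_cm_two` (chosen once by `Classical.choose`, so every consumer reads the same function — the one-source rule by construction).  Binders: the structural
data `μ νG μK νI 𝓕I ν 𝓕 β μZ`, `χ` self-dual unitary trivial on `ℝ_{>0}`, the normalised section `φ ∈ V(χ, K_max, 1)`. [cite: MoeglinWaldspurger1995, IV.1.10] [cite: Rogawski1990, §13.6 p. 208] -/
def scatteringScalarM1 : ℂ → ℂ :=
  (chi_scattering_real_poles_m1_complete_cm_two L μ νG μK νI h𝓕I ν h𝓕N h𝓕1 h𝓕c hβ hμZ hχ hρ hsd hφV hφc hφM hφinf hφ1 hφ1r).choose_spec.choose_spec.choose_spec.choose default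

/-- **THE SINGULAR SET OF THE SCATTERING SCALAR, AS A DEFINITION**: the points where `scatteringScalarM1` is NOT analytic — a subset of the package's pole set `P`, hence closed,
co-discrete and `⊆ {Re ≤ 1}` (read-backs below); by definition the scalar is analytic off it. [cite: MoeglinWaldspurger1995, IV.1.10] -/
def scatteringPolesM1 : Set ℂ :=
  {z : ℂ | ¬ AnalyticAt ℂ (scatteringScalarM1 L μ νG μK νI h𝓕I ν h𝓕N h𝓕1 h𝓕c hβ hμZ hχ hρ hsd hφV hφc hφM hφinf hφ1 hφ1r) z}

/-- **THE TUBE FORMULA** of the defined scalar: `s(z) = (ν𝓕)⁻¹ · φ(1)⁻¹ · ∫_{N(𝔸)} f_z^φ(w₀(v·1)) dν` on `{1 < Re z}` — Langlands' un-normalised `c(z)`. [cite: MoeglinWaldspurger1995, II.1.7] -/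
theorem scatteringScalarM1_tube (z : ℂ) (hz : 1 < z.re) :
    scatteringScalarM1 L μ νG μK νI h𝓕I ν h𝓕N h𝓕1 h𝓕c hβ hμZ hχ hρ hsd hφV hφc hφM hφinf hφ1 hφ1r z = (((ν 𝓕).toReal⁻¹ : ℝ) : ℂ) * ((φ 1)⁻¹ * ∫ v : ↥(adelicUnipotent (↥(maximalRealSubfield L)) L (IsCMField.complexConj L) 2), flatSectionU φ z
        ((quasiSplit (↥(maximalRealSubfield L)) L (IsCMField.complexConj L) 2).toAdelic (weylLongU (IsCMField.complexConj L : L →+* L)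
          (rfl : (StdForm.antidiagonal 2).over L = (StdForm.antidiagonal 2).over L)) * ((v : (quasiSplit (↥(maximalRealSubfield L)) L (IsCMField.complexConj L) 2).Adelic) * 1)) ∂ν) := by
  have h := (chi_scattering_real_poles_m1_complete_cm_two L μ νG μK νI h𝓕I ν h𝓕N h𝓕1 h𝓕c hβ hμZ hχ hρ hsd hφV hφc hφM hφinf hφ1 hφ1r).choose_spec.choose_spec.choose_spec.choose_spec.choose_spec
  exact h.2.2.1 z hz

/-- **NORMAL FORM**: the defined scalar is meromorphic in normal form on `ℂ`. [cite: MoeglinWaldspurger1995, IV.1.10] -/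
theorem meromorphicNFOn_scatteringScalarM1 : MeromorphicNFOn (scatteringScalarM1 L μ νG μK νI h𝓕I ν h𝓕N h𝓕1 h𝓕c hβ hμZ hχ hρ hsd hφV hφc hφM hφinf hφ1 hφ1r) univ := by
  have h := (chi_scattering_real_poles_m1_complete_cm_two L μ νG μK νI h𝓕I ν h𝓕N h𝓕1 h𝓕c hβ hμZ hχ hρ hsd hφV hφc hφM hφinf hφ1 hφ1r).choose_spec.choose_spec.choose_spec.choose_spec.choose_spec
  exact h.2.1.2.2.2.1 default

/-- **ANALYTICITY OFF THE SINGULAR SET** (by definition). [cite: MoeglinWaldspurger1995, IV.1.10] -/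
theorem analyticAt_scatteringScalarM1 (z : ℂ) (hz : z ∉ scatteringPolesM1 L μ νG μK νI h𝓕I ν h𝓕N h𝓕1 h𝓕c hβ hμZ hχ hρ hsd hφV hφc hφM hφinf hφ1 hφ1r) :
    AnalyticAt ℂ (scatteringScalarM1 L μ νG μK νI h𝓕I ν h𝓕N h𝓕1 h𝓕c hβ hμZ hχ hρ hsd hφV hφc hφM hφinf hφ1 hφ1r) z :=
  not_not.1 hz

set_option maxHeartbeats 800000 in  -- two def-vs-`Classical.choose` conversions of the package scalar in one declaration (measured > 200000; elaboration only)
/-- **THE SINGULAR SET IS CLOSED, CO-DISCRETE AND LIES IN `{Re ≤ 1}`** (it is contained in the package's pole set, off which the chosen scalar is analytic). [cite: MoeglinWaldspurger1995, IV.1.10] -/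
theorem scatteringPolesM1_closed_codiscrete_re_le :
    IsClosed (scatteringPolesM1 L μ νG μK νI h𝓕I ν h𝓕N h𝓕1 h𝓕c hβ hμZ hχ hρ hsd hφV hφc hφM hφinf hφ1 hφ1r) ∧
      (∀ z₀ : ℂ, ∀ᶠ s in 𝓝[≠] z₀, s ∉ scatteringPolesM1 L μ νG μK νI h𝓕I ν h𝓕N h𝓕1 h𝓕c hβ hμZ hχ hρ hsd hφV hφc hφM hφinf hφ1 hφ1r) ∧
      ∀ z ∈ scatteringPolesM1 L μ νG μK νI h𝓕I ν h𝓕N h𝓕1 h𝓕c hβ hμZ hχ hρ hsd hφV hφc hφM hφinf hφ1 hφ1r, z.re ≤ 1 := by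
  have h := (chi_scattering_real_poles_m1_complete_cm_two L μ νG μK νI h𝓕I ν h𝓕N h𝓕1 h𝓕c hβ hμZ hχ hρ hsd hφV hφc hφM hφinf hφ1 hφ1r).choose_spec.choose_spec.choose_spec.choose_spec.choose_spec
  -- the chosen scalar is analytic off the package's pole set, which is co-discrete and lies in `{Re ≤ 1}`
  have hqa := h.2.1.2.2.2.2.2.2.2.2.2.2.1 default
  have hPcd := h.2.1.2.2.2.2.2.2.2.1
  have hPre := h.2.1.2.2.2.2.2.2.2.2.1
  refine ⟨?_, fun z₀ => (hPcd z₀).mono fun w hw => ?_, fun z hz => hPre z ?_⟩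
  · have ho : IsOpen {z : ℂ | AnalyticAt ℂ (scatteringScalarM1 L μ νG μK νI h𝓕I ν h𝓕N h𝓕1 h𝓕c hβ hμZ hχ hρ hsd hφV hφc hφM hφinf hφ1 hφ1r) z} := isOpen_analyticAt ℂ _
    simpa only [scatteringPolesM1, Set.compl_setOf] using ho.isClosed_compl
  · exact not_not.2 (hqa w hw)
  · by_contra hzP
    exact hz (hqa z hzP)

end Package

/-! ## §3 `Tr(M_H(χ) I_{H,χ}(f))` at the maximal level -/

section Trace

variable [BorelSpace (quasiSplit (↥(maximalRealSubfield L)) L (IsCMField.complexConj L) 2).Adelic] [MeasurableSpace (AdeleRing (𝓞 L) L)ˣ] [BorelSpace (AdeleRing (𝓞 L) L)ˣ]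
variable (μ : Measure (quasiSplit (↥(maximalRealSubfield L)) L (IsCMField.complexConj L) 2).automorphicQuotient) [(quasiSplit (↥(maximalRealSubfield L)) L (IsCMField.complexConj L) 2).IsAutomorphicMeasure μ]
variable (νG : Measure (quasiSplit (↥(maximalRealSubfield L)) L (IsCMField.complexConj L) 2).Adelic) [νG.IsHaarMeasure] [νG.IsInvInvariant] [SFinite νG]
variable (μK : Measure ↥((standardMaximalCompactGL 2 L).comap (adelicVal (↥(maximalRealSubfield L)) L (IsCMField.complexConj L) 2 ((StdForm.antidiagonal 2).over L)) : Subgroup (quasiSplit (↥(maximalRealSubfield L)) L (IsCMField.complexConj L) 2).Adelic)) [μK.IsHaarMeasure]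
variable (νI : Measure (AdeleRing (𝓞 L) L)ˣ) [νI.IsHaarMeasure]
variable {𝓕I : Set (AdeleRing (𝓞 L) L)ˣ} (h𝓕I : IsIdeleClassDomain L 𝓕I)
variable (ν : Measure ↥(adelicUnipotent (↥(maximalRealSubfield L)) L (IsCMField.complexConj L) 2)) [ν.IsHaarMeasure] [ν.IsMulRightInvariant] [ν.IsInvInvariant]
variable {𝓕 : Set ↥(adelicUnipotent (↥(maximalRealSubfield L)) L (IsCMField.complexConj L) 2)}
variable (h𝓕N : IsFundamentalDomain ↥(rationalUnipotent (↥(maximalRealSubfield L)) L (IsCMField.complexConj L) 2) 𝓕 ν) (h𝓕1 : ν 𝓕 = 1) (h𝓕c : IsCompact (closure 𝓕))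
variable {β : (quasiSplit (↥(maximalRealSubfield L)) L (IsCMField.complexConj L) 2).Adelic → ℝ≥0∞}
variable (hβ : IsCoveringWeight ↥((arithmeticBorel (↥(maximalRealSubfield L)) L (IsCMField.complexConj L) 2).map (quasiSplit (↥(maximalRealSubfield L)) L (IsCMField.complexConj L) 2).arithmeticSubgroup.subtype) β)
variable {μZ : Measure (borelQuotient (↥(maximalRealSubfield L)) L (IsCMField.complexConj L) 2)} [SFinite μZ]
variable (hμZ : ∀ f : borelQuotient (↥(maximalRealSubfield L)) L (IsCMField.complexConj L) 2 → ℝ≥0∞, Measurable f → ∫⁻ z, f z ∂μZ = ∫⁻ g, β g * f (toBorelQuotient (↥(maximalRealSubfield L)) L (IsCMField.complexConj L) 2 g) ∂νG)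
variable {χ : HeckeCharacter L} (hχ : χ.IsUnitary) (hρ : ∀ r : ℝ≥0ˣ, χ (posRealIdele L r) = 1) (hsd : reflectChar (IsCMField.complexConj L) χ = χ)
variable {φ : (quasiSplit (↥(maximalRealSubfield L)) L (IsCMField.complexConj L) 2).Adelic → ℂ}
variable (hφV : φ ∈ chiSectionSpace χ ((standardMaximalCompactGL 2 L).comap (adelicVal (↥(maximalRealSubfield L)) L (IsCMField.complexConj L) 2 ((StdForm.antidiagonal 2).over L)) : Subgroup (quasiSplit (↥(maximalRealSubfield L)) L (IsCMField.complexConj L) 2).Adelic) (fun _ => 1))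
variable (hφc : Continuous φ) {Mφ : ℝ} (hφM : ∀ x, ‖φ x‖ ≤ Mφ)
variable (hφinf : ∀ a : arch (↥(maximalRealSubfield L)) L (IsCMField.complexConj L) 2 ((StdForm.antidiagonal 2).over L), φ (archToAdelic (↥(maximalRealSubfield L)) L (IsCMField.complexConj L) 2 _ a) = φ 1)
variable (hφ1 : φ 1 ≠ 0) (hφ1r : conj (φ 1) = φ 1)

/-- **`Tr(M_H(χ) I_{H,χ}(f))` AT THE MAXIMAL LEVEL** (token `trMIH` of `Ch13Sec5Defs` :165, `U(Φ₂)` factor, bi-`K_max`-invariant `f`): `M_H(χ)(½)` acts on the `K_max`-line by THE scattering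
scalar at the centre, so the trace is `s(½) · ŝ_f(χ, ½)`. [cite: Rogawski1990, §13.6 (13.6.1) p. 208] [cite: Arthur1982EisensteinII, Thm. 8.2] -/
def trMIH_m1 (f : (quasiSplit (↥(maximalRealSubfield L)) L (IsCMField.complexConj L) 2).Adelic → ℂ) : ℂ :=
  scatteringScalarM1 L μ νG μK νI h𝓕I ν h𝓕N h𝓕1 h𝓕c hβ hμZ hχ hρ hsd hφV hφc hφM hφinf hφ1 hφ1r (1 / 2) * trIH_m1 L νG φ f

/-- Read-back of `trMIH_m1` (definitional). [folklore] -/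
theorem trMIH_m1_def (f : (quasiSplit (↥(maximalRealSubfield L)) L (IsCMField.complexConj L) 2).Adelic → ℂ) :
    trMIH_m1 L μ νG μK νI h𝓕I ν h𝓕N h𝓕1 h𝓕c hβ hμZ hχ hρ hsd hφV hφc hφM hφinf hφ1 hφ1r f =
      scatteringScalarM1 L μ νG μK νI h𝓕I ν h𝓕N h𝓕1 h𝓕c hβ hμZ hχ hρ hsd hφV hφc hφM hφinf hφ1 hφ1r (1 / 2) * trIH_m1 L νG φ f := rfl

end Trace

end Summit.HodgeConjecture.HodgeConjecture.Cruxes.H413.K2E1ContSpecTraceNumbersU2Defs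

end
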